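import Mathlib
import Literature.AlgebraicGeometry.Resolution.CobordantGame
import Literature.AlgebraicGeometry.Resolution.FormalCoordinateChange
import Summits.ResolutionOfSingularities.ResolutionOfSingularities.Theorems.WeightedInvariantLocalWeightedDropPlaneWon
import Summits.ResolutionOfSingularities.ResolutionOfSingularities.Theorems.WeightedInvariantLocalWeightedDropConeDichotomy
import Summits.ResolutionOfSingularities.ResolutionOfSingularities.Theorems.WeightedInvariantLocalWeightedDropTangentConeCut
import Summits.ResolutionOfSingularities.ResolutionOfSingularities.Theorems.WeightedInvariantLocalWeightedDropPlaneNonNCCount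

/-!
# `WeightedInvariant.LocalWeightedDrop`, line `hasse-ridge-face-selection`: surface double points are won (`p ≠ 2`)

Crux item stmt-ResolutionOfSingularities-8899 (route `ResolutionOfSingularities/WeightedInvariant`), skeleton v15 of the
line `hasse-ridge-face-selection`, registered stub `stub_surfaceDoublePointsWon`.

**Theorem.**  Over an algebraically closed field of characteristic `p ≠ 2`, EVERY singular surface germ
`f ∈ k[[x₀, x₁, x₂]]` of order `2` is in the winning region of the local weighted (cobordant) resolution game:
`CobordantGame.Won k 3 f`.  UNCONDITIONAL from v15 on — the last classical input, the strong embedded resolution of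
plane curve germs `PlaneGermNonNCCount`, is now the theorem `planeGermNonNCCount`.

**Proof.**  Tangent-quadric dichotomy (`stub_coneDichotomy`): a hyperbolic pair ⇒ `TangentConeCut.hyperbolicStartsWon`
(two variables fewer: singular one-variable germs are won, `PlaneWon.lineWon`); a square `ℓ²` with `ℓ ≠ 0` ⇒
`TangentConeCut.tameDoublePointSurfaceWon` (square splitting `x₀² + H(x₁,x₂)`, the double-point lift over the plane branch
game, and the plane branch drop from the now-proved count); `ℓ = 0` contradicts `ord f = 2` (a degree-`2` exponent is
`eᵢ + eⱼ`).
-/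

set_option linter.dupNamespace false -- mandated namespace of this single-conjunct summit

namespace Summit.ResolutionOfSingularities.ResolutionOfSingularities.Theorems

open Literature.AlgebraicGeometry.Resolution

namespace SurfaceDoublePoints

/-- A degree-`2` exponent vector is `eᵢ + eⱼ` for some `i, j`. -/
theorem exists_eq_single_add_single {N : ℕ} (d : Fin N →₀ ℕ) (hd : d.degree = 2) :
    ∃ i j : Fin N, d = Finsupp.single i 1 + Finsupp.single j 1 := by
  classical
  have hne : d ≠ 0 := by
    rintro rfl
    simp at hd
  obtain ⟨i, hi⟩ : ∃ i, d i ≠ 0 := by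
    by_contra h
    push Not at h
    exact hne (Finsupp.ext h)
  have hle : Finsupp.single i 1 ≤ d := Finsupp.single_le_iff.mpr (Nat.one_le_iff_ne_zero.mpr hi)
  set d' := d - Finsupp.single i 1 with hd'
  have hdd : d = d' + Finsupp.single i 1 := (tsub_add_cancel_of_le hle).symm
  have hdeg' : d'.degree = 1 := by
    have h := congrArg Finsupp.degree hdd
    rw [map_add, Finsupp.degree_single, hd] at h
    omega
  rcases FormalCoordChange.eq_zero_or_single_of_degree_lt_two d' (by omega) with h0 | ⟨j, hj⟩
  · rw [h0, map_zero] at hdeg'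
    exact absurd hdeg' (by norm_num)
  · exact ⟨j, i, by rw [hdd, hj]⟩

end SurfaceDoublePoints

/-- SURFACE DOUBLE POINTS ARE WON IN ODD CHARACTERISTIC (registered stub `stub_surfaceDoublePointsWon`): over an
algebraically closed field of characteristic `p ≠ 2`, every singular `f ∈ k[[x₀,x₁,x₂]]` of order `2` is in the
winning region of the local weighted resolution game.  Unconditional: hyperbolic tangent quadric by the hyperbolic
lift, square tangent quadric by square splitting + the double-point lift over the plane branch game, whose rank comes
from the now-proved strong embedded resolution of plane curve germs (`planeGermNonNCCount`). -/
theorem stub_surfaceDoublePointsWon : ∀ (p : ℕ), p.Prime → p ≠ 2 →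
    ∀ (k : Type) [Field k] [CharP k p] [IsAlgClosed k] (f : MvPowerSeries (Fin 3) k),
      CobordantGame.IsSingular k f → f.order = 2 → CobordantGame.Won k 3 f := by
  intro p hp hp2 k _ _ _ f hf hord
  rcases stub_coneDichotomy k 1 f hf with hhyp | ⟨ℓ, hℓ⟩
  · exact TangentConeCut.hyperbolicStartsWon (fun g hg => PlaneWon.lineWon g hg) f hf hhyp
  · by_cases hℓ0 : ∀ i, ℓ i = 0
    · exfalso
      have hq : ∀ i j : Fin 3, MvPowerSeries.coeff (Finsupp.single i 1 + Finsupp.single j 1) f = 0 := by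
        intro i j
        rw [hℓ i j]
        have : (∑ l, MvPowerSeries.C (ℓ l) * MvPowerSeries.X l : MvPowerSeries (Fin 3) k) = 0 :=
          Finset.sum_eq_zero fun l _ => by rw [hℓ0 l, map_zero, zero_mul]
        rw [this, zero_pow two_ne_zero, map_zero]
      obtain ⟨⟨d, hd, hdeg⟩, -⟩ := MvPowerSeries.order_eq_nat.mp hord
      obtain ⟨i, j, rfl⟩ := SurfaceDoublePoints.exists_eq_single_add_single d hdeg
      exact hd (hq i j)
    · push Not at hℓ0
      exact TangentConeCut.tameDoublePointSurfaceWon (fun k _ _ => planeGermNonNCCount k) p hp hp2 k f hf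
        ⟨ℓ, hℓ0, hℓ⟩

end Summit.ResolutionOfSingularities.ResolutionOfSingularities.Theorems
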